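import Mathlib
import Summits.ValiantsHypothesis.ValiantsHypothesis.Theses.NewtonUnitEquations
import Literature.Computability.AlgebraicComplexity.NewtonPolygonTauTransfer

/-!
# `DissociatedUniform` (stmt-ValiantsHypothesis-5905) — load-bearing hypotheses (negative lane)

Negative knowledge for the crux
`Summit.ValiantsHypothesis.ValiantsHypothesis.Theses.NewtonUnitEquations.DissociatedUniform`
(routes NewtonUnitEquations rank 2 / NewtonFrames rank 3), from the standing disprover's
`Cruxes/DissociatedUniform/Disproof.lean` §2, with the witness taken from the tree
(`Literature…KPTT.kpttPoly n = Σ_{i<2^n} X^i Y^{2i(2^n−1−i)}`, all `2^n` support points are vertices,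
`KPTT.newtonVertexCount_kpttPoly`):

* `dissociatedUniform_false_without_card` — with `∀ j, #A j ≤ t` deleted the statement is FALSE
  (`k = m = 1`, `t = 0`, `A 0 = supp F`, `F = kpttPoly (C+1)`: `2^(C+1) > (1·1·0+2)^C` vertices);
* `dissociatedUniform_false_without_supp` — with `supp f i j ⊆ A j` deleted it is FALSE (`A j = ∅`);
* `WithoutDissoc` (drop injectivity of the sum map) is recorded as a `def`; it is implied by — and up to
  the constant equivalent to — KPTT's Conjecture 1 in polynomial form (`KPTT.newtonTauConjecture`,
  open, "believed false" per Chatterjee–Gajjar–Tengse 2023): `withoutDissoc_of_newtonTauConjecture`.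
So any proof of the crux must use the two bookkeeping hypotheses; the mathematical weight sits on
DISSOCIATION and on the `k` in the base of the bound. [folklore]
-/

namespace Summit.ValiantsHypothesis.ValiantsHypothesis.Theorems.DissociatedUniform.Negative

open MvPolynomial
open Literature.Computability.AlgebraicComplexity
open Literature.Computability.AlgebraicComplexity.KPTT

/-- The crux with the cardinality hypothesis `∀ j, #A j ≤ t` DELETED. -/
def WithoutCard : Prop :=
  ∃ C : ℕ, ∀ (k m t : ℕ) (A : Fin m → Finset (Fin 2 →₀ ℕ)) (f : Fin k → Fin m → MvPolynomial (Fin 2) ℂ),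
    (∀ i j, (f i j).support ⊆ A j) →
    (∀ a b : Fin m → (Fin 2 →₀ ℕ), (∀ j, a j ∈ A j) → (∀ j, b j ∈ A j) → ∑ j, a j = ∑ j, b j → a = b) →
    (Set.extremePoints ℝ (convexHull ℝ ((fun e : Fin 2 →₀ ℕ => fun i : Fin 2 => ((e i : ℕ) : ℝ)) ''
      ((∑ i, ∏ j, f i j).support : Set (Fin 2 →₀ ℕ))))).ncard ≤ (k * m * t + 2) ^ C

/-- The crux with the support hypothesis `∀ i j, supp f i j ⊆ A j` DELETED. -/
def WithoutSupp : Prop :=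
  ∃ C : ℕ, ∀ (k m t : ℕ) (A : Fin m → Finset (Fin 2 →₀ ℕ)) (f : Fin k → Fin m → MvPolynomial (Fin 2) ℂ),
    (∀ j, (A j).card ≤ t) →
    (∀ a b : Fin m → (Fin 2 →₀ ℕ), (∀ j, a j ∈ A j) → (∀ j, b j ∈ A j) → ∑ j, a j = ∑ j, b j → a = b) →
    (Set.extremePoints ℝ (convexHull ℝ ((fun e : Fin 2 →₀ ℕ => fun i : Fin 2 => ((e i : ℕ) : ℝ)) ''
      ((∑ i, ∏ j, f i j).support : Set (Fin 2 →₀ ℕ))))).ncard ≤ (k * m * t + 2) ^ C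

/-- The crux with DISSOCIATION deleted (common alphabets `A j` of size `≤ t`, no injectivity). OPEN. -/
def WithoutDissoc : Prop :=
  ∃ C : ℕ, ∀ (k m t : ℕ) (A : Fin m → Finset (Fin 2 →₀ ℕ)) (f : Fin k → Fin m → MvPolynomial (Fin 2) ℂ),
    (∀ j, (A j).card ≤ t) → (∀ i j, (f i j).support ⊆ A j) →
    (Set.extremePoints ℝ (convexHull ℝ ((fun e : Fin 2 →₀ ℕ => fun i : Fin 2 => ((e i : ℕ) : ℝ)) ''
      ((∑ i, ∏ j, f i j).support : Set (Fin 2 →₀ ℕ))))).ncard ≤ (k * m * t + 2) ^ C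

/-- KPTT's Conjecture 1 in polynomial form (`KPTT.newtonTauConjecture`, `t`-sparse factors) implies the
dissociation-free form of the crux: supports inside alphabets of size `≤ t` are `t`-sparse.  (The
converse holds with `C ↦ 2C+1` by taking `A j = ⋃_i supp f_ij`, `#A j ≤ kt`; not recorded.) [folklore] -/
theorem withoutDissoc_of_newtonTauConjecture (h : newtonTauConjecture) : WithoutDissoc := by
  obtain ⟨C, hC⟩ := h
  refine ⟨C, fun k m t A f hcard hsupp => ?_⟩
  exact hC k m t f fun i j => (Finset.card_le_card (hsupp i j)).trans (hcard j)

/-- The one-cell instance: at `k = m = 1` the crux's vertex count of `f 0 0 = F` is `newtonVertexCount F`. -/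
theorem vertexCount_fin_one (F : MvPolynomial (Fin 2) ℂ) :
    (Set.extremePoints ℝ (convexHull ℝ ((fun e : Fin 2 →₀ ℕ => fun i : Fin 2 => ((e i : ℕ) : ℝ)) ''
      ((∑ i : Fin 1, ∏ j : Fin 1, (fun (_ : Fin 1) (_ : Fin 1) => F) i j).support :
        Set (Fin 2 →₀ ℕ))))).ncard = newtonVertexCount F := by
  simp [newtonVertexCount]

/-- `2^(C+1)` vertices beat the bound `(1·1·0+2)^C`. [folklore] -/
theorem bound_violated (C : ℕ) : ¬ newtonVertexCount (kpttPoly (C + 1)) ≤ (1 * 1 * 0 + 2) ^ C := by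
  rw [newtonVertexCount_kpttPoly]
  simp [Nat.pow_succ]

/-- **Any proof of the crux must use `∀ j, #A j ≤ t`.**  Witness `k = m = 1`, `t = 0`, `A 0 = supp F`,
`F = kpttPoly (C+1)` (KPTT's parabola witness): `2^(C+1) > 2^C` vertices. [folklore] -/
theorem dissociatedUniform_false_without_card : ¬ WithoutCard := by
  rintro ⟨C, hC⟩
  have h := hC 1 1 0 (fun _ => (kpttPoly (C + 1)).support) (fun _ _ => kpttPoly (C + 1))
    (fun _ _ => subset_rfl)
    (fun a b _ _ hab => by
      funext j
      have hj : j = 0 := Subsingleton.elim j 0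
      subst hj
      simpa using hab)
  rw [vertexCount_fin_one] at h
  exact bound_violated C h

/-- **Any proof of the crux must use `∀ i j, supp f i j ⊆ A j`.**  Witness `k = m = 1`, `t = 0`,
`A 0 = ∅` (so `#A 0 ≤ 0` and dissociation is vacuous), same `F`. [folklore] -/
theorem dissociatedUniform_false_without_supp : ¬ WithoutSupp := by
  rintro ⟨C, hC⟩
  have h := hC 1 1 0 (fun _ => ∅) (fun _ _ => kpttPoly (C + 1)) (fun _ => by simp)
    (fun a b ha _ _ => absurd (ha 0) (by simp))
  rw [vertexCount_fin_one] at h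
  exact bound_violated C h

end Summit.ValiantsHypothesis.ValiantsHypothesis.Theorems.DissociatedUniform.Negative
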